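import Mathlib
import HarnessLib
import Summits.HubbardSuperconductivity.HubbardSuperconductivity.Theorems.KLProgrammeH10TwoPointLimitKlAnisoOnUmklappCountWideTolWindow
import Summits.HubbardSuperconductivity.HubbardSuperconductivity.Theorems.KLProgrammeH10TwoPointLimitKlAnisoOffUmklappCountWindow
import Summits.HubbardSuperconductivity.HubbardSuperconductivity.Theorems.KLProgrammeH10TwoPointLimitKlAnisoWideNarrowDichotomy

/-!
# Route `KLProgramme` — K3 engine (stmt-HubbardSuperconductivity-20437), stub (b) (ℓ)/(I2), located item «ON-CLASS-KB»: the `hRoff`-shape row of the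
# recipe `B := ON ∩ NARROW(Θ)` — OFF the umklapp class OR (on it and) WIDE, the relative count has exponent `(m+1) − 3`

Cell gate-hubbard-kl, seat p4 g13 (memo HOME/prover-p4/CLAIM-U-API.md §3c).  Glue of three landed rows, no new mathematics: for a coarse tuple `σ′` that is
NOT «on the umklapp class of some `G₀ ≠ 0` (tolerance `(m+1)·C·w_k`, `C` = the off-class row's constant) AND narrow (all non-pinned half-turned indices
within `⌊(Θ + 5w_k)/w_k⌋` of one sector modulo `2^k`)», either the off-class row (p4 g12, `card_relCount_prescribed_offUmklapp_klAniso_le_window`: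
`D^{m+1}·2^{(J′−k)((m+1)−3)}`) applies, or — by `wide_or_narrowCone` at `Θ′ = Θ + 5w_k` — two non-pinned legs are transversal and the WIDE row at
tolerance `C` (`card_relCount_prescribed_onUmklapp_klAniso_le_window_wide_tol`, wedge budget `Ψ₀ := π/2`, which every pair angle satisfies) applies:
`5^{m+1}(m+1)²·B_fib·(3·2^{J′−k})^{(m+1)−3}`.  The bound is the sum of the two.

* `pairAngle_le_pi_div_two` — `pairAngle θ₁ θ₂ ≤ π/2`;
* **`card_relCount_prescribed_offOrWide_klAniso_le_window`** — the row, in the K3 stubs' binders (`FrameOK`, KL regime, `μ ∈ klWindowC`).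
PROVED; no definitions, no named facts; nothing here asserts anything about the model or superconductivity.
References: BGM 2006 App. A3 [cite: BenfattoGiulianiMastropietro2006]; BGM 2003 §3.1 Lemma 3.1 [cite: BenfattoGiulianiMastropietro2003].
-/

noncomputable section

namespace Summit.HubbardSuperconductivity.HubbardSuperconductivity.Theorems.PerturbedFermiCurve

set_option linter.dupNamespace false -- summit = problem name (single-conjunct summit), D-0017

open Classical
open Real Set Finset
open Literature.MathematicalPhysics.QuantumLattice Literature.MathematicalPhysics.QuantumLattice.BandSectorCounting
open Literature.MathematicalPhysics.QuantumLattice.FermiRG Literature.MathematicalPhysics.QuantumLattice.FermiRG.BGM2003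
open Literature.Probability.LatticeModels
open Summit.HubbardSuperconductivity.HubbardSuperconductivity.Theorems.DispersionFlow
open Summit.HubbardSuperconductivity.HubbardSuperconductivity.Theorems.KLRegimeSplit
open Summit.HubbardSuperconductivity.HubbardSuperconductivity.Theorems.KLProgrammeLegKernels
open Summit.HubbardSuperconductivity.HubbardSuperconductivity.Theorems.TorusFourierL2

/-- `pairAngle θ₁ θ₂ ≤ π/2` (an angle between LINES). -/
theorem pairAngle_le_pi_div_two (θ₁ θ₂ : ℝ) : pairAngle θ₁ θ₂ ≤ π / 2 := by
  unfold pairAngle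
  rcases le_total (FermiRG.torusDist (θ₁ - θ₂)) (π / 2) with h | h
  · exact (min_le_left _ _).trans h
  · exact (min_le_right _ _).trans (by linarith)

/-- **OFF the umklapp class OR WIDE ⇒ exponent `(m+1) − 3`** (the `hRoff` side of the recipe `B := ON ∩ NARROW(Θ)`).  There are constants `C, D > 0` (the
off-class row's), `c₂ ≥ 0`, `cb, K₁, K₂, c₀, c₂′ > 0` and `C_w > 0` (the wide row's) and a scale `k₀` such that for every renormalisation package (`Gfr ≥ 0`)
there are `c₃, U₀ > 0` with: for all KL binders, `μ ∈ klWindowC`, admissible frames, `m + 1 ≥ 4` legs, scales `k₀ ≤ k ≤ J′` with `(m+1)(C_w + C)·w_k < 2π`,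
every `A″ ⊆ bgmSectorSet`, prescribed legs `E ∋ p` with labels `τ″`, every coarse `σ′`, every regime parameter `Θ` and fibre constant `B_fib` of the wide row
at wedge budget `π/2`: if `σ′` is NOT (on the class of some `G₀ ≠ 0` at tolerance `(m+1)Cw_k` AND narrow at radius `⌊(Θ + 5w_k)/w_k⌋` modulo `2^k`), then
`#{σ″ ∈ A″ : σ″|_E = τ″|_E, σ″ refines σ′} ≤ D^{m+1}·2^{(J′−k)((m+1)−3)} + 5^{m+1}(m+1)²·B_fib·(3·2^{J′−k})^{(m+1)−3}`.
[cite: BenfattoGiulianiMastropietro2006, App. A3 Lemma A3.1; BenfattoGiulianiMastropietro2003, §3.1 Lemma 3.1 (4.3), §7.4] -/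
theorem card_relCount_prescribed_offOrWide_klAniso_le_window :
    ∃ C : ℝ, 0 < C ∧ ∃ D : ℝ, 0 < D ∧ ∃ Cw : ℝ, 0 < Cw ∧
      ∃ c₂ cb K₁ K₂ c₀ c₂' : ℝ, 0 ≤ c₂ ∧ 0 < cb ∧ 2 + c₂ ≤ K₁ ∧ 0 < K₂ ∧ 0 < c₀ ∧ 0 < c₂' ∧ ∃ k₀ : ℕ,
      ∀ Rc : RenConsts, (∀ j, 0 ≤ Rc.Gfr j) →
      ∃ c₃ : ℝ, 0 < c₃ ∧ ∃ U₀ : ℝ, 0 < U₀ ∧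
      ∀ c : ℝ, 0 < c → c ≤ c₃ → ∀ U : ℝ, 0 < U → U ≤ U₀ → ∀ β : ℝ, klBetaMin ≤ β → β ≤ Real.exp (c / U ^ 2) →
      ∀ μ ∈ klWindowC, ∀ (ν : ℝ) (K : TrigPolyC4v), FrameOK Rc U (nScales β) ν K →
      ∀ (L M : ℕ) [NeZero L] (m k J' : ℕ), k₀ ≤ k → k ≤ J' → 3 ≤ m →
      ((m : ℝ) + 1) * (Cw + C) * sectorWidth k < 2 * π →
      ∀ (A'' : Finset (Fin (m + 1) → SectorLeg (sectorCount J'))),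
        A'' ⊆ bgmSectorSet L M (klAnisoFamily L M β μ K klE0 J') (m + 1) →
      ∀ (E : Finset (Fin (m + 1))) (τ'' : Fin (m + 1) → SectorLeg (sectorCount J')) (p : Fin (m + 1)), p ∈ E →
      ∀ σ' : Fin (m + 1) → SectorLeg (sectorCount k),
      ∀ (Θ LΨ Bfib : ℝ), LΨ = (m + 1 : ℕ) + c₂ * (π / 2 + 5 * sectorWidth k) / (K₁ * Θ) → (2 : ℝ) ^ (-(J' : ℤ)) ≤ Θ →
        cb * (2 : ℝ) ^ (-(J' : ℤ)) ≤ Θ → K₂ * LΨ * (cb * (2 : ℝ) ^ (-(J' : ℤ))) ≤ c₂' * Θ →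
        max ((2 * ((2 * c₀ * K₂ * cb / π + 1) * LΨ)) ^ 2) (4 * cb ^ 2 * K₂ ^ 2 / 1 ^ 2 * LΨ ^ 2) ≤ Bfib →
      ¬ ((∃ G₀ : Fin 2 → ℤ, G₀ ≠ 0 ∧ ∀ j : Fin 2,
            |∑ i, (if (σ' i).2 = 0 then klFermiPoint μ K (sectorCenter k (σ' i).1.1) j
              else -klFermiPoint μ K (sectorCenter k (σ' i).1.1) j) - 2 * π * (G₀ j : ℝ)| ≤ ((m : ℝ) + 1) * C * sectorWidth k) ∧
         (∃ b : Fin (sectorCount k), ∀ i, i ≠ p → ∃ Dz : ℤ, |Dz| ≤ (⌊(Θ + 5 * sectorWidth k) / sectorWidth k⌋₊ : ℕ) ∧ ((2 : ℤ) ^ k) ∣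
          ((((if (σ' i).2 = 0 then ((σ' i).1.1 : ℕ) else
              if ((σ' i).1.1 : ℕ) < 2 ^ k then ((σ' i).1.1 : ℕ) + 2 ^ k else ((σ' i).1.1 : ℕ) - 2 ^ k : ℕ) : ℤ)) - b - Dz))) →
      ((((A''.filter fun σ'' => (∀ e ∈ E, σ'' e = τ'' e) ∧ ∀ i,
          (∃ q : FreqMomentum L M, klAnisoFamily L M β μ K klE0 J' (σ'' i).1.1 q ≠ 0 ∧
            bgmFatMultiplier L M klE0 β (nambuXiCT L μ K) k (σ' i).1.1 q ≠ 0) ∧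
          (σ' i).1.2 = (σ'' i).1.2 ∧ (σ' i).2 = (σ'' i).2).card : ℕ) : ℝ)) ≤
        D ^ (m + 1) * (2 : ℝ) ^ ((J' - k) * ((m + 1) - 3)) +
          (5 : ℝ) ^ (m + 1) * ((m + 1 : ℕ) ^ 2 * (Bfib * (3 * (2 : ℝ) ^ (J' - k)) ^ ((m + 1) - 3))) := by
  obtain ⟨C, hC, D, hD, k₁, hoffR⟩ := card_relCount_prescribed_offUmklapp_klAniso_le_window
  obtain ⟨Cw, hCw, c₂, cb, K₁, K₂, c₀, c₂', h1, h2, h3, h4, h5, h6, k₂, hwideR⟩ :=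
    card_relCount_prescribed_onUmklapp_klAniso_le_window_wide_tol
  refine ⟨C, hC, D, hD, Cw, hCw, c₂, cb, K₁, K₂, c₀, c₂', h1, h2, h3, h4, h5, h6, max k₁ k₂, fun Rc hR => ?_⟩
  obtain ⟨c₃, hc₃, U₀, hU₀, hoff⟩ := hoffR Rc hR
  obtain ⟨c₃', hc₃', U₀', hU₀', hwide⟩ := hwideR Rc hR
  refine ⟨min c₃ c₃', lt_min hc₃ hc₃', min U₀ U₀', lt_min hU₀ hU₀', ?_⟩
  intro c hc hcle U hU hUle β hβmin hβc μ hμ ν K hK L M _ m k J' hk₀ hkJ hm hsmall A'' hA'' E τ'' p hp σ' Θ LΨ Bfib hLΨ hΘt hΘδ hΘη hBfib hnot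
  have hk₁ : k₁ ≤ k := (le_max_left _ _).trans hk₀
  have hk₂ : k₂ ≤ k := (le_max_right _ _).trans hk₀
  have hc₁ : c ≤ c₃ := hcle.trans (min_le_left _ _)
  have hc₂ : c ≤ c₃' := hcle.trans (min_le_right _ _)
  have hU₁ : U ≤ U₀ := hUle.trans (min_le_left _ _)
  have hU₂ : U ≤ U₀' := hUle.trans (min_le_right _ _)
  -- nonnegativity of the two partial bounds
  have hB₁ : (0 : ℝ) ≤ D ^ (m + 1) * (2 : ℝ) ^ ((J' - k) * ((m + 1) - 3)) := by positivity
  have hBfib0 : 0 ≤ Bfib := le_trans (le_trans (sq_nonneg _) (le_max_left _ _)) hBfib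
  have hB₂ : (0 : ℝ) ≤ (5 : ℝ) ^ (m + 1) * ((m + 1 : ℕ) ^ 2 * (Bfib * (3 * (2 : ℝ) ^ (J' - k)) ^ ((m + 1) - 3))) := by positivity
  by_cases hoffc : ∀ G : Fin 2 → ℤ, G ≠ 0 → ∃ j : Fin 2, ((m : ℝ) + 1) * C * sectorWidth k <
      |∑ i, (if (σ' i).2 = 0 then klFermiPoint μ K (sectorCenter k (σ' i).1.1) j
          else -klFermiPoint μ K (sectorCenter k (σ' i).1.1) j) - 2 * π * (G j : ℝ)|
  · -- OFF the class
    have h := hoff c hc hc₁ U hU hU₁ β hβmin hβc μ hμ ν K hK L M m k J' hk₁ hkJ hm A'' hA'' E τ'' p hp σ' hoffc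
    linarith
  · -- ON the class of some `G₀ ≠ 0`; not narrow ⇒ wide
    push Not at hoffc
    obtain ⟨G₀, hG₀, hon⟩ := hoffc
    have hnotnarrow : ¬ ∃ b : Fin (sectorCount k), ∀ i, i ≠ p → ∃ Dz : ℤ, |Dz| ≤ (⌊(Θ + 5 * sectorWidth k) / sectorWidth k⌋₊ : ℕ) ∧
        ((2 : ℤ) ^ k) ∣ ((((if (σ' i).2 = 0 then ((σ' i).1.1 : ℕ) else
          if ((σ' i).1.1 : ℕ) < 2 ^ k then ((σ' i).1.1 : ℕ) + 2 ^ k else ((σ' i).1.1 : ℕ) - 2 ^ k : ℕ) : ℤ)) - b - Dz) :=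
      fun hn => hnot ⟨⟨G₀, hG₀, hon⟩, hn⟩
    rcases wide_or_narrowCone σ' p (Θ + 5 * sectorWidth k) with ⟨i₀, j₀, hi₀, hj₀, hfar⟩ | hnarrow
    · have hwedge : ∀ i : Fin (m + 1), pairAngle
          (sectorCenter k (if (σ' p).2 = 0 then ((σ' p).1.1 : ℕ) else
            if ((σ' p).1.1 : ℕ) < 2 ^ k then ((σ' p).1.1 : ℕ) + 2 ^ k else ((σ' p).1.1 : ℕ) - 2 ^ k))
          (sectorCenter k (if (σ' i).2 = 0 then ((σ' i).1.1 : ℕ) else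
            if ((σ' i).1.1 : ℕ) < 2 ^ k then ((σ' i).1.1 : ℕ) + 2 ^ k else ((σ' i).1.1 : ℕ) - 2 ^ k)) ≤ π / 2 :=
        fun i => pairAngle_le_pi_div_two _ _
      have h := hwide c hc hc₂ U hU hU₂ β hβmin hβc μ hμ ν K hK L M m k J' hk₂ hkJ hm A'' hA'' E τ'' p hp σ' G₀ C hon hsmall
        (π / 2) (by positivity) hwedge Θ LΨ Bfib hLΨ hΘt hΘδ hΘη hBfib i₀ j₀ hi₀ hj₀ hfar
      linarith
    · exact absurd hnarrow hnotnarrow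

end Summit.HubbardSuperconductivity.HubbardSuperconductivity.Theorems.PerturbedFermiCurve

end
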